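import Summits.Ventures.PercRepro0.Merge
import Summits.Ventures.PercRepro0.BranchCount

/-!
# Trifurcations: definition, invariance, boxes as finsets, Lemma 3.5 per component (UNIQUENESS-p6-v1 §3.0, §3.5), seat p6

Kernel-checked twin, on `Defs.lean`, of the objects of Step 3 of the uniqueness proof (the counting bound
itself and `δ = 0` are in `TrifCount.lean`):

* `closeAt ω x` = `ω^{(x)}` (all bonds at `x` closed); `IsTrif ω x` = Definition 3.0 (three open bonds at `x`
  whose far endpoints lie in pairwise distinct infinite clusters of `ω^{(x)}`); measurable
  (`measurableSet_isTrif`), translation covariant (`isTrif_shiftConfig`), so `P_p(x is a trifurcation)`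
  does not depend on `x` (`P_isTrif_eq`);
* `boxFinset d n` / `bdryFinset d n` = `Λ_n` and `∂Λ_{n+1} = Λ_{n+1} ∖ Λ_n` as finsets, of cardinalities
  `(2n+1)^d` and `(2n+3)^d − (2n+1)^d`;
* `card_add_two_le_of_mutual`: Lemma 3.5 for the vertices of one connected component of an arbitrary
  graph (the abstract `BranchCount.card_add_two_le` with `Vs` = the component);
* `trifFinset ω n` = `R_n(ω)`, the trifurcations of `ω` inside `Λ_n`.
-/

namespace Summit.Ventures.PercRepro0.Trif

open MeasureTheory ProbabilityTheory unitInterval Set Function Filter Topology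
open scoped ENNReal
open Summit.Ventures.PercRepro0.Defs
open Summit.Ventures.PercRepro0.Merge (mem_box_succ_of_adj)
open Summit.Ventures.PercRepro0.BranchCount (card_add_two_le reach_avoid_symm reach_avoid_trans
  reach_avoid_ne reach_avoid_nest)

variable {d : ℕ}

/-! ## Definition 3.0 -/

/-- `ω^{(x)}`: the configuration `ω` with every bond at `x` closed. -/
def closeAt (ω : Config d) (x : Vertex d) : Config d := ω \ {e | x ∈ e}

/-- `x` is a trifurcation of `ω`: three open bonds `{x, w_i}` whose far endpoints `w_i` lie in pairwise
distinct infinite open clusters of `ω^{(x)}`. -/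
def IsTrif (ω : Config d) (x : Vertex d) : Prop :=
  ∃ w : Fin 3 → Vertex d, (∀ i, s(x, w i) ∈ ω ∧ s(x, w i) ∈ bonds d) ∧
    (∀ i, ConnInf d (closeAt ω x) (w i)) ∧ ∀ i j, i ≠ j → ¬ Conn d (closeAt ω x) (w i) (w j)

/-- `ω^{(x)} ⊆ ω`. -/
theorem closeAt_subset (ω : Config d) (x : Vertex d) : closeAt ω x ⊆ ω := Set.sdiff_subset

/-- A walk of `ω^{(x)}` starting away from `x` never visits `x`. -/
theorem notMem_support_of_closeAt {ω : Config d} {x : Vertex d} :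
    ∀ {a b : Vertex d} (p : (openGraph d (closeAt ω x)).Walk a b), a ≠ x → x ∉ p.support := by
  intro a b p
  induction p with
  | nil =>
    intro ha
    rw [SimpleGraph.Walk.support_nil, List.mem_singleton]
    exact fun e => ha e.symm
  | @cons u v w hadj p ih =>
    intro hu
    rw [SimpleGraph.Walk.support_cons, List.mem_cons, not_or]
    refine ⟨fun e => hu e.symm, ih ?_⟩
    intro hv
    subst hv
    rw [openGraph, SimpleGraph.fromEdgeSet_adj] at hadj
    exact hadj.1.1.2 (by simp)

/-- Removing a set of bonds is measurable. -/
theorem measurable_sdiff_const (S : Set (Sym2 (Vertex d))) :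
    Measurable fun ω : Config d => ω \ S := by
  refine measurable_set_iff.2 fun a => ?_
  by_cases ha : a ∈ S
  · have h : (fun ω : Config d => a ∈ ω \ S) = fun _ => False := by
      funext ω
      simp [ha]
    rw [h]
    exact measurable_const
  · have h : (fun ω : Config d => a ∈ ω \ S) = fun ω => a ∈ ω := by
      funext ω
      simp [ha]
    rw [h]
    exact measurable_set_mem a

/-- `ω ↦ ω^{(x)}` is measurable. -/
theorem measurable_closeAt (x : Vertex d) : Measurable fun ω : Config d => closeAt ω x :=
  measurable_sdiff_const _

/-- The event `{x is a trifurcation}` is measurable. -/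
theorem measurableSet_isTrif (x : Vertex d) : MeasurableSet {ω : Config d | IsTrif ω x} := by
  have : {ω : Config d | IsTrif ω x} = ⋃ w : Fin 3 → Vertex d,
      (⋂ i, ({ω : Config d | s(x, w i) ∈ ω} ∩ {_ω : Config d | s(x, w i) ∈ bonds d})) ∩
      ((⋂ i, (fun ω : Config d => closeAt ω x) ⁻¹' {ω : Config d | ConnInf d ω (w i)}) ∩
        ⋂ i, ⋂ j, ⋂ (_ : i ≠ j),
          (fun ω : Config d => closeAt ω x) ⁻¹' {ω : Config d | Conn d ω (w i) (w j)}ᶜ) := by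
    ext ω
    simp only [IsTrif, Set.mem_setOf_eq, Set.mem_iUnion, Set.mem_inter_iff, Set.mem_iInter,
      Set.mem_preimage, Set.mem_compl_iff]
  rw [this]
  refine MeasurableSet.iUnion fun w => MeasurableSet.inter ?_ (MeasurableSet.inter ?_ ?_)
  · exact MeasurableSet.iInter fun i => (measurableSet_mem _).inter (MeasurableSet.const _)
  · exact MeasurableSet.iInter fun i => (measurable_closeAt x) (measurableSet_connInf (w i))
  · exact MeasurableSet.iInter fun i => MeasurableSet.iInter fun j => MeasurableSet.iInter fun _ =>
      (measurable_closeAt x) (measurableSet_conn (w i) (w j)).compl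

/-! ## Translation covariance -/

/-- `x ∈ e ↔ x + z ∈ e + z`. -/
theorem mem_bondShift_iff (z x : Vertex d) (e : Sym2 (Vertex d)) :
    x + z ∈ bondShift z e ↔ x ∈ e := by
  show x + z ∈ Sym2.map (· + z) e ↔ x ∈ e
  rw [Sym2.mem_map]
  constructor
  · rintro ⟨a, ha, hax⟩
    rwa [add_left_injective z hax] at ha
  · intro hx
    exact ⟨x, hx, rfl⟩

/-- Closing the bonds at `x` commutes with translation. -/
theorem closeAt_shiftConfig (z : Vertex d) (ω : Config d) (x : Vertex d) :
    closeAt (shiftConfig z ω) x = shiftConfig z (closeAt ω (x + z)) := by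
  ext e
  show (e ∈ shiftConfig z ω ∧ x ∉ e) ↔ bondShift z e ∈ closeAt ω (x + z)
  show (bondShift z e ∈ ω ∧ x ∉ e) ↔ (bondShift z e ∈ ω ∧ x + z ∉ bondShift z e)
  rw [mem_bondShift_iff]

/-- Membership of a pair in a translated configuration. -/
theorem pair_mem_shiftConfig (z : Vertex d) (ω : Config d) (x y : Vertex d) :
    s(x, y) ∈ shiftConfig z ω ↔ s(x + z, y + z) ∈ ω := by
  show bondShift z s(x, y) ∈ ω ↔ _
  rw [bondShift_pair]

/-- A pair is a bond iff its translate is. -/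
theorem pair_mem_bonds_add (z x y : Vertex d) : s(x + z, y + z) ∈ bonds d ↔ s(x, y) ∈ bonds d := by
  have h := bondShift_mem_bonds z s(x, y)
  rwa [bondShift_pair] at h

/-- `x` is a trifurcation of `T_z ω` iff `x + z` is a trifurcation of `ω`. -/
theorem isTrif_shiftConfig (z : Vertex d) (ω : Config d) (x : Vertex d) :
    IsTrif (shiftConfig z ω) x ↔ IsTrif ω (x + z) := by
  unfold IsTrif
  rw [closeAt_shiftConfig]
  constructor
  · rintro ⟨w, h1, h2, h3⟩
    refine ⟨fun i => w i + z, fun i => ?_, fun i => ?_, fun i j hij => ?_⟩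
    · exact ⟨(pair_mem_shiftConfig z ω x (w i)).1 (h1 i).1, (pair_mem_bonds_add z x (w i)).2 (h1 i).2⟩
    · exact (connInf_shiftConfig z _ (w i)).1 (h2 i)
    · exact fun h => h3 i j hij ((conn_shiftConfig z _ (w i) (w j)).2 h)
  · rintro ⟨w, h1, h2, h3⟩
    refine ⟨fun i => w i - z, fun i => ?_, fun i => ?_, fun i j hij => ?_⟩
    · have h := h1 i
      rw [← sub_add_cancel (w i) z] at h
      exact ⟨(pair_mem_shiftConfig z ω x (w i - z)).2 h.1, (pair_mem_bonds_add z x (w i - z)).1 h.2⟩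
    · exact (connInf_shiftConfig z _ (w i - z)).2 (by simpa using h2 i)
    · intro h
      have h' := (conn_shiftConfig z _ (w i - z) (w j - z)).1 h
      simp only [sub_add_cancel] at h'
      exact h3 i j hij h'

/-- `P_p(x is a trifurcation) = P_p(0 is a trifurcation)` for every vertex `x`. -/
theorem P_isTrif_eq (p : I) (x : Vertex d) :
    P d p {ω : Config d | IsTrif ω x} = P d p {ω : Config d | IsTrif ω 0} := by
  have : {ω : Config d | IsTrif ω x} = shiftConfig x ⁻¹' {ω : Config d | IsTrif ω 0} := by
    ext ω
    simp only [Set.mem_setOf_eq, Set.mem_preimage, isTrif_shiftConfig, zero_add]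
  rw [this, P_shiftConfig_preimage x p (measurableSet_isTrif 0)]

/-! ## Boxes and boundaries as finsets -/

/-- The box `Λ_n` as a finset. -/
noncomputable def boxFinset (d n : ℕ) : Finset (Vertex d) :=
  Fintype.piFinset fun _ : Fin d => Finset.Icc (-(n : ℤ)) n

/-- Membership in `boxFinset`. -/
theorem mem_boxFinset {n : ℕ} {x : Vertex d} : x ∈ boxFinset d n ↔ x ∈ box d n := by
  simp only [boxFinset, Fintype.mem_piFinset, Finset.mem_Icc, box, Set.mem_setOf_eq, abs_le]

/-- `|Λ_n| = (2n+1)^d`. -/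
theorem card_boxFinset (n : ℕ) : (boxFinset d n).card = (2 * n + 1) ^ d := by
  rw [boxFinset, Fintype.card_piFinset, Finset.prod_const, Finset.card_univ, Fintype.card_fin]
  congr 1
  rw [Int.card_Icc]
  omega

/-- The boundary `∂Λ_{n+1} = Λ_{n+1} ∖ Λ_n` as a finset. -/
noncomputable def bdryFinset (d n : ℕ) : Finset (Vertex d) := boxFinset d (n + 1) \ boxFinset d n

/-- `Λ_n ⊆ Λ_{n+1}`. -/
theorem boxFinset_subset_succ (n : ℕ) : boxFinset d n ⊆ boxFinset d (n + 1) := by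
  intro x hx
  rw [mem_boxFinset] at hx ⊢
  intro i
  exact (hx i).trans (by push_cast; linarith)

/-- `|∂Λ_{n+1}| = (2n+3)^d − (2n+1)^d`. -/
theorem card_bdryFinset (n : ℕ) : (bdryFinset d n).card = (2 * n + 3) ^ d - (2 * n + 1) ^ d := by
  rw [bdryFinset, Finset.card_sdiff_of_subset (boxFinset_subset_succ n), card_boxFinset, card_boxFinset]
  congr 2

/-- Membership in the boundary finset. -/
theorem mem_bdryFinset {n : ℕ} {x : Vertex d} :
    x ∈ bdryFinset d n ↔ x ∈ box d (n + 1) ∧ x ∉ box d n := by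
  simp only [bdryFinset, Finset.mem_sdiff, mem_boxFinset]

/-- The trifurcations of `ω` inside `Λ_n`, as a finset (`R_n(ω)`). -/
noncomputable def trifFinset (ω : Config d) (n : ℕ) : Finset (Vertex d) := by
  classical exact (boxFinset d n).filter (IsTrif ω)

/-- Membership in `trifFinset`. -/
theorem mem_trifFinset {ω : Config d} {n : ℕ} {x : Vertex d} :
    x ∈ trifFinset ω n ↔ x ∈ box d n ∧ IsTrif ω x := by
  classical
  simp only [trifFinset, Finset.mem_filter, mem_boxFinset]

/-! ## Lemma 3.5 on one connected component of an arbitrary graph -/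

/-- Lemma 3.5 (UNIQUENESS-p6-v1) for the vertex set `C` of one connected component of a graph `K` (`C` is
closed under reachability and any two of its vertices are reachable from each other): `R ⊆ C` finite
nonempty, `Y ⊆ C` finite, `R ∩ Y = ∅`, every `v ∈ R` has three vertices of `Y` pairwise not joined by a
walk avoiding `v`; then `|R| + 2 ≤ |Y|`. The proof is `BranchCount.card_add_two_le_of_connected` with
`Vs = C` (only the walk `v' → b` of the nesting step used connectivity). -/
theorem card_add_two_le_of_mutual {V : Type*} (K : SimpleGraph V) (C : Set V)
    (hC : ∀ a ∈ C, ∀ b, K.Reachable a b → b ∈ C) (hCC : ∀ a ∈ C, ∀ b ∈ C, K.Reachable a b)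
    (R Y : Finset V) (hR : (R : Set V) ⊆ C) (hY : (Y : Set V) ⊆ C)
    (hne : R.Nonempty) (hRY : Disjoint R Y)
    (h3 : ∀ v ∈ R, ∃ y₁ ∈ Y, ∃ y₂ ∈ Y, ∃ y₃ ∈ Y,
      (¬ ∃ p : K.Walk y₁ y₂, v ∉ p.support) ∧ (¬ ∃ p : K.Walk y₁ y₃, v ∉ p.support) ∧
      (¬ ∃ p : K.Walk y₂ y₃, v ∉ p.support)) :
    R.card + 2 ≤ Y.card := by
  classical
  let B : V → Set (Set V) := fun v =>
    {S | ∃ a, a ≠ v ∧ a ∈ C ∧ S = {b | ∃ p : K.Walk a b, v ∉ p.support}}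
  have class_eq : ∀ {v a a' : V}, (∃ p : K.Walk a a', v ∉ p.support) →
      {b | ∃ p : K.Walk a b, v ∉ p.support} = {b | ∃ p : K.Walk a' b, v ∉ p.support} := by
    intro v a a' haa'
    exact Set.ext fun b => ⟨fun hb => reach_avoid_trans K (reach_avoid_symm K haa') hb,
      fun hb => reach_avoid_trans K haa' hb⟩
  have hRv : ∀ v ∈ R, ∀ y ∈ Y, y ≠ v := fun v hv y hy e => Finset.disjoint_left.mp hRY hv (e ▸ hy)
  have self : ∀ {v} (y : V), y ≠ v → ∃ p : K.Walk y y, v ∉ p.support := fun y hy =>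
    ⟨SimpleGraph.Walk.nil, by
      rw [SimpleGraph.Walk.support_nil, List.mem_singleton]; exact fun e => hy e.symm⟩
  have mem_C_of_class : ∀ {v a b : V}, a ∈ C → (∃ p : K.Walk a b, v ∉ p.support) → b ∈ C :=
    fun ha ⟨p, _⟩ => hC _ ha _ ⟨p⟩
  refine card_add_two_le R.card C R Y B rfl hne hR hY hRY ?_ ?_ ?_ ?_ ?_
  · rintro v _ W ⟨a, _, haC, rfl⟩ b hb
    exact ⟨mem_C_of_class haC hb, (reach_avoid_ne K hb).2⟩
  · intro v _ W hW W' hW' hWW'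
    obtain ⟨a, _, _, rfl⟩ := hW
    obtain ⟨a', _, _, rfl⟩ := hW'
    rw [Set.disjoint_left]
    exact fun b hb hb' => hWW' (class_eq (reach_avoid_trans K hb (reach_avoid_symm K hb')))
  · intro v _ u hu
    have huv : u ≠ v := fun e => hu.2 (Set.mem_singleton_iff.mpr e)
    exact ⟨_, ⟨u, huv, hu.1, rfl⟩, self u huv⟩
  · intro v _ v' hv' hvv' W' hW' hv'W' W'' hW'' hvW''
    obtain ⟨a', _, _, rfl⟩ := hW'
    obtain ⟨a'', _, ha''C, rfl⟩ := hW''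
    intro b hb
    have hbC : b ∈ C := mem_C_of_class ha''C hb
    obtain ⟨q⟩ := hCC v' (hR hv') b hbC
    rcases reach_avoid_nest K hvv' hvW'' q hb with hv'W'' | hb'
    · exact absurd (reach_avoid_ne K hv'W'').2 (fun e => e rfl)
    · exact reach_avoid_trans K hv'W' hb'
  · intro v hv
    obtain ⟨y₁, hy₁, y₂, hy₂, y₃, hy₃, n₁₂, n₁₃, n₂₃⟩ := h3 v hv
    have hne₁ := hRv v hv y₁ hy₁
    have hne₂ := hRv v hv y₂ hy₂
    have hne₃ := hRv v hv y₃ hy₃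
    have distinct : ∀ {y y' : V}, y' ≠ v → (¬ ∃ p : K.Walk y y', v ∉ p.support) →
        {b | ∃ p : K.Walk y b, v ∉ p.support} ≠ {b | ∃ p : K.Walk y' b, v ∉ p.support} := by
      intro y y' hy' hn e
      have : y' ∈ {b | ∃ p : K.Walk y b, v ∉ p.support} := by rw [e]; exact self y' hy'
      exact hn this
    exact ⟨_, ⟨y₁, hne₁, hY hy₁, rfl⟩, _, ⟨y₂, hne₂, hY hy₂, rfl⟩, _, ⟨y₃, hne₃, hY hy₃, rfl⟩,
      distinct hne₂ n₁₂, distinct hne₃ n₁₃, distinct hne₃ n₂₃,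
      ⟨y₁, self y₁ hne₁, hy₁⟩, ⟨y₂, self y₂ hne₂, hy₂⟩, ⟨y₃, self y₃ hne₃, hy₃⟩⟩

end Summit.Ventures.PercRepro0.Trif
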